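import Summits.BirchSwinnertonDyer.BirchSwinnertonDyer.Theses.PrintX9
import Literature.NumberTheory.EllipticCurves.MatarNekovar2019.IrreducibleOverQuadraticFieldProofs
import HarnessLib

/-!
# Route PrintX9 — aside `MatarNekovarIrreducibleBaseChange` (stmt-BirchSwinnertonDyer-20533), PROVED by name

Cell `bsd-print-x9` (D-0131 (2) PRINT tier), seat `bsd-print-x9-p1` (prover p1, gen 2), on the typer's TURNKEY
(ty1 g3, 2026-08-27T17:04Z). The aside item-states the named fact Matar–Nekovář 2019 Prop. 5.26 (2)
(`MatarNekovar2019.prop526_hasIrreducibleModPGaloisRep_baseChange`: for `E/ℚ`, `K` quadratic with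
`(N_E, d_K) = 1`, `p ≠ 2`, `E[p]` irreducible over `ℚ` ⟹ irreducible over `K`), which seat ty1 has now PROVED
in the tree (`…prop526_hasIrreducibleModPGaloisRep_baseChange_holds`, file
`Literature/NumberTheory/EllipticCurves/MatarNekovar2019/IrreducibleOverQuadraticFieldProofs.lean`, p548563 +
p549855: Serre's Prop. 11/12 road, all odd `p`). This file reads that theorem on the route declaration so the
aside closes BY NAME. HONEST STATUS: closes one print aside of route PrintX9; no crux moves; BSD is not proved.
-/

namespace Summit.BirchSwinnertonDyer.Rank1Residual.X9

/-- **Aside 20533 of route PrintX9** — Matar–Nekovář 2019 Prop. 5.26 (2) (irreducibility of `E[p]` over a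
quadratic field `K` with `(N_E, d_K) = 1`, `p ≠ 2`, from irreducibility over `ℚ`), as the route declaration
`Theses.PrintX9.MatarNekovarIrreducibleBaseChange`; proof = the typer's theorem
`MatarNekovar2019.prop526_hasIrreducibleModPGaloisRep_baseChange_holds`.
[cite: MatarNekovar2019, Prop. 5.26 (2) (p. 492) and its proof (p. 493)]
[cite: Serre1972, Prop. 11 and Prop. 12] -/
theorem printX9_matarNekovarIrreducibleBaseChange_proof :
    Summit.BirchSwinnertonDyer.BirchSwinnertonDyer.Theses.PrintX9.MatarNekovarIrreducibleBaseChange :=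
  Literature.NumberTheory.EllipticCurves.MatarNekovar2019.prop526_hasIrreducibleModPGaloisRep_baseChange_holds

end Summit.BirchSwinnertonDyer.Rank1Residual.X9
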